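import Mathlib
import Summits.Ventures.PercRepro2.WForm

/-!
# The alternating (Gibbs-sampler) argument for W-forms, I: conditional weights, the transfer
operator `K`, and the Doeblin bounds (blind cell PercRepro2, mine-1 g15; proofs/MINE1-W-THEOREM.md)

For a weight `W : α → R` and a compatibility relation `D` on a finite type `α`:
`cw s t = W s · 1[D s t]` (the conditional weight given `t`), `Z t = ∑_s cw s t`,
`K u t = ∑_s cw s t u s / Z t` (the conditional expectation given `t`), `q t = W t · Z t`
(the marginal), `pairSum u v = ∑_t q t u t v t`. Identities: `Q D W g h = ∑_t W t ∑_s cw s t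
(g s − g t)(h s − h t)` (`Q_eq_sum_cw`), `pairSum u v = ∑_t W t ∑_s cw s t u s v s` for symmetric
`D` (`pairSum_eq`), and `K` preserves the `q`-mean (`sum_q_mul_K`).
With a hub `t₀` compatible with everything (`D t₀ t` for all `t`) of positive weight, every
normaliser is positive and `K (·, t₀) ≥ ε := W t₀ / ∑ W`, which gives the **Doeblin bounds**
`lo u + ε (u t₀ − lo u) ≤ K u t ≤ hi u − ε (hi u − u t₀)` (`lo_add_le_K`, `K_le_hi_sub`):
the transfer operator contracts oscillations by `1 − ε`. Part II (`WAltTheorem.lean`) turns these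
into the theorem `Q_nonneg_of_alternating`.
-/

namespace Summit.Ventures.PercRepro2.WForm

section AltDefs

variable {R : Type*} [Field R]
variable {α : Type*} [Fintype α]
variable (D : α → α → Prop) [DecidableRel D] (W : α → R)

/-- The conditional weight: `W s` if `D s t`, else `0`. -/
def cw (s t : α) : R := if D s t then W s else 0

/-- The normaliser `Z t = ∑_s cw s t`. -/
def Z (t : α) : R := ∑ s, cw D W s t

/-- The conditional-expectation operator `K u t = (∑_s cw s t * u s) / Z t`. -/
noncomputable def K (u : α → R) (t : α) : R := (∑ s, cw D W s t * u s) / Z D W t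

/-- The `t`-marginal `q t = W t * Z t`. -/
def q (t : α) : R := W t * Z D W t

/-- The pair sum `∑_t q t * (u t * v t)`. -/
def pairSum (u v : α → R) : R := ∑ t, q D W t * (u t * v t)

variable {D W}

omit [Fintype α] in
/-- The conditional weight on a compatible pair. -/
lemma cw_of_D {s t : α} (h : D s t) : cw D W s t = W s := by simp [cw, h]

omit [Fintype α] in
/-- The conditional weight vanishes on an incompatible pair. -/
lemma cw_of_not_D {s t : α} (h : ¬ D s t) : cw D W s t = 0 := by simp [cw, h]

omit [Fintype α] in
/-- `coef s t = W t * cw s t`. -/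
lemma coef_eq_mul_cw (s t : α) : coef D W s t = W t * cw D W s t := by
  unfold coef cw
  split_ifs <;> ring

/-- The W-form as a sum over `t` of `W t` times a conditional sum. -/
lemma Q_eq_sum_cw (g h : α → R) :
    Q D W g h = ∑ t, W t * ∑ s, cw D W s t * ((g s - g t) * (h s - h t)) := by
  unfold Q S
  rw [Finset.sum_comm]
  refine Finset.sum_congr rfl fun t _ => ?_
  rw [Finset.mul_sum]
  refine Finset.sum_congr rfl fun s _ => ?_
  rw [coef_eq_mul_cw]; ring

/-- `K` of a shifted function. -/
lemma K_sub_const (u : α → R) (c : R) {t : α} (hZ : Z D W t ≠ 0) :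
    K D W (fun s => u s - c) t = K D W u t - c := by
  unfold K
  have : ∑ s, cw D W s t * (u s - c) = (∑ s, cw D W s t * u s) - c * Z D W t := by
    unfold Z
    rw [Finset.mul_sum, ← Finset.sum_sub_distrib]
    refine Finset.sum_congr rfl fun s _ => ?_
    ring
  rw [this, sub_div, mul_div_assoc, div_self hZ, mul_one]

/-- `K` of a negated function. -/
lemma K_neg (u : α → R) (t : α) : K D W (fun s => - u s) t = - K D W u t := by
  unfold K; rw [← neg_div, ← Finset.sum_neg_distrib]
  congr 1; refine Finset.sum_congr rfl fun s _ => ?_; ring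

/-- The conditional sum is `K u t * Z t`. -/
lemma sum_cw_mul_eq_K_mul_Z (u : α → R) {t : α} (hZ : Z D W t ≠ 0) :
    ∑ s, cw D W s t * u s = K D W u t * Z D W t := by
  unfold K
  rw [div_mul_cancel₀ _ hZ]

omit [Fintype α] in
/-- `coef` is symmetric when `D` is. -/
lemma coef_symm' (hD : ∀ s t, D s t → D t s) (s t : α) : coef D W s t = coef D W t s := by
  unfold coef
  by_cases h : D s t
  · rw [if_pos h, if_pos (hD s t h), mul_comm]
  · have h' : ¬ D t s := fun h' => h (hD t s h')
    rw [if_neg h, if_neg h']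

/-- `∑_t coef s t = q s` when `D` is symmetric. -/
lemma sum_coef_eq_q (hD : ∀ s t, D s t → D t s) (s : α) : ∑ t, coef D W s t = q D W s := by
  unfold q Z
  rw [Finset.mul_sum]
  refine Finset.sum_congr rfl fun t _ => ?_
  rw [coef_symm' hD, coef_eq_mul_cw]

/-- `K` preserves the `q`-mean (the relation `D` being symmetric). -/
lemma sum_q_mul_K (hD : ∀ s t, D s t → D t s) (hZ : ∀ t, Z D W t ≠ 0) (u : α → R) :
    ∑ t, q D W t * K D W u t = ∑ t, q D W t * u t := by
  have e1 : ∀ t, q D W t * K D W u t = ∑ s, coef D W s t * u s := by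
    intro t
    unfold q K
    have h1 : Z D W t * ((∑ s, cw D W s t * u s) / Z D W t) = ∑ s, cw D W s t * u s := by
      have := hZ t
      field_simp
    have : W t * Z D W t * ((∑ s, cw D W s t * u s) / Z D W t) = W t * ∑ s, cw D W s t * u s := by
      rw [mul_assoc, h1]
    rw [this, Finset.mul_sum]
    refine Finset.sum_congr rfl fun s _ => ?_
    rw [coef_eq_mul_cw]; ring
  simp_rw [e1]
  rw [Finset.sum_comm]
  refine Finset.sum_congr rfl fun s _ => ?_
  rw [← Finset.sum_mul, sum_coef_eq_q hD, mul_comm]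

/-- The pair sum in terms of `coef`. -/
lemma pairSum_eq (hD : ∀ s t, D s t → D t s) (u v : α → R) :
    pairSum D W u v = ∑ t, W t * ∑ s, cw D W s t * (u s * v s) := by
  unfold pairSum
  have e : ∀ s, q D W s * (u s * v s) = ∑ t, coef D W s t * (u s * v s) := by
    intro s
    rw [← Finset.sum_mul, sum_coef_eq_q hD]
  simp_rw [e]
  rw [Finset.sum_comm]
  refine Finset.sum_congr rfl fun t _ => ?_
  rw [Finset.mul_sum]
  refine Finset.sum_congr rfl fun s _ => ?_
  rw [coef_eq_mul_cw]; ring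

end AltDefs

section HiLo

variable {R : Type*} [LinearOrder R] {α : Type*} [Fintype α]

/-- The maximum of `u` over `α` (nonempty through `t₀`). -/
noncomputable def hi (t₀ : α) (u : α → R) : R := Finset.univ.sup' ⟨t₀, Finset.mem_univ t₀⟩ u

/-- The minimum of `u` over `α`. -/
noncomputable def lo (t₀ : α) (u : α → R) : R := Finset.univ.inf' ⟨t₀, Finset.mem_univ t₀⟩ u

/-- Every value is at most the maximum. -/
lemma le_hi (t₀ : α) (u : α → R) (t : α) : u t ≤ hi t₀ u :=
  Finset.le_sup' u (Finset.mem_univ t)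

/-- Every value is at least the minimum. -/
lemma lo_le (t₀ : α) (u : α → R) (t : α) : lo t₀ u ≤ u t :=
  Finset.inf'_le u (Finset.mem_univ t)

/-- An upper bound of all values bounds the maximum. -/
lemma hi_le {t₀ : α} {u : α → R} {c : R} (h : ∀ t, u t ≤ c) : hi t₀ u ≤ c :=
  Finset.sup'_le _ _ fun t _ => h t

/-- A lower bound of all values bounds the minimum. -/
lemma le_lo {t₀ : α} {u : α → R} {c : R} (h : ∀ t, c ≤ u t) : c ≤ lo t₀ u :=
  Finset.le_inf' _ _ fun t _ => h t

/-- The minimum is at most the maximum. -/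
lemma lo_le_hi (t₀ : α) (u : α → R) : lo t₀ u ≤ hi t₀ u :=
  (lo_le t₀ u t₀).trans (le_hi t₀ u t₀)

end HiLo

section AltNonneg

variable {R : Type*} [Field R] [LinearOrder R] [IsStrictOrderedRing R]
variable {α : Type*} [Fintype α] [DecidableEq α]
variable {D : α → α → Prop} [DecidableRel D] {W : α → R}

omit [Fintype α] [DecidableEq α] [IsStrictOrderedRing R] in
/-- Conditional weights are nonnegative. -/
lemma cw_nonneg (hW : ∀ s, 0 ≤ W s) (s t : α) : 0 ≤ cw D W s t := by
  unfold cw; split_ifs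
  · exact hW s
  · exact le_refl 0

omit [Fintype α] [DecidableEq α] [IsStrictOrderedRing R] in
/-- Conditional weights are at most the weights. -/
lemma cw_le_W (hW : ∀ s, 0 ≤ W s) (s t : α) : cw D W s t ≤ W s := by
  unfold cw; split_ifs
  · exact le_refl _
  · exact hW s

omit [DecidableEq α] in
/-- The normaliser is nonnegative. -/
lemma Z_nonneg (hW : ∀ s, 0 ≤ W s) (t : α) : 0 ≤ Z D W t :=
  Finset.sum_nonneg fun s _ => cw_nonneg (D := D) hW s t

omit [DecidableEq α] in
/-- The normaliser is at most the total weight. -/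
lemma Z_le_sum (hW : ∀ s, 0 ≤ W s) (t : α) : Z D W t ≤ ∑ s, W s :=
  Finset.sum_le_sum fun s _ => cw_le_W (D := D) hW s t

omit [DecidableEq α] in
/-- With a hub `t₀` compatible with `t`, `W t₀ ≤ Z t`. -/
lemma W_le_Z (hW : ∀ s, 0 ≤ W s) {t₀ t : α} (h : D t₀ t) : W t₀ ≤ Z D W t := by
  have := Finset.single_le_sum (f := fun s => cw D W s t) (fun s _ => cw_nonneg (D := D) hW s t)
    (Finset.mem_univ t₀)
  rw [cw_of_D h] at this
  exact this

omit [DecidableEq α] in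
/-- With a hub of positive weight compatible with `t`, the normaliser is positive. -/
lemma Z_pos (hW : ∀ s, 0 ≤ W s) {t₀ t : α} (h : D t₀ t) (h0 : 0 < W t₀) : 0 < Z D W t :=
  lt_of_lt_of_le h0 (W_le_Z hW h)

omit [DecidableEq α] in
/-- The marginal weight is nonnegative. -/
lemma q_nonneg (hW : ∀ s, 0 ≤ W s) (t : α) : 0 ≤ q D W t :=
  mul_nonneg (hW t) (Z_nonneg hW t)

/-- The contraction constant `ε = W t₀ / ∑ W`. -/
noncomputable def eps (W : α → R) (t₀ : α) : R := W t₀ / ∑ s, W s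

omit [DecidableEq α] in
/-- The total weight is positive when one weight is. -/
lemma sum_W_pos (hW : ∀ s, 0 ≤ W s) {t₀ : α} (h0 : 0 < W t₀) : 0 < ∑ s, W s :=
  lt_of_lt_of_le h0 (Finset.single_le_sum (fun s _ => hW s) (Finset.mem_univ t₀))

omit [DecidableEq α] in
/-- `0 ≤ ε`. -/
lemma eps_nonneg (hW : ∀ s, 0 ≤ W s) {t₀ : α} (h0 : 0 < W t₀) : 0 ≤ eps W t₀ :=
  div_nonneg (hW t₀) (sum_W_pos hW h0).le

omit [DecidableEq α] in
/-- `ε ≤ 1`. -/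
lemma eps_le_one (hW : ∀ s, 0 ≤ W s) {t₀ : α} (h0 : 0 < W t₀) : eps W t₀ ≤ 1 := by
  unfold eps
  rw [div_le_one (sum_W_pos hW h0)]
  exact Finset.single_le_sum (fun s _ => hW s) (Finset.mem_univ t₀)

omit [DecidableEq α] in
/-- `ε ≤ W t₀ / Z t`: the hub carries at least `ε` of every conditional weight. -/
lemma eps_le_div_Z (hW : ∀ s, 0 ≤ W s) {t₀ t : α} (h : D t₀ t) (h0 : 0 < W t₀) :
    eps W t₀ ≤ W t₀ / Z D W t := by
  unfold eps
  exact div_le_div_of_nonneg_left (hW t₀) (Z_pos hW h h0) (Z_le_sum hW t)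

omit [LinearOrder R] [IsStrictOrderedRing R] in
/-- Splitting the conditional sum at the hub. -/
lemma sum_cw_mul_eq_hub_add (u : α → R) (t₀ t : α) :
    ∑ s, cw D W s t * u s = cw D W t₀ t * u t₀ + ∑ s ∈ Finset.univ.erase t₀, cw D W s t * u s :=
  (Finset.add_sum_erase _ _ (Finset.mem_univ t₀)).symm

omit [LinearOrder R] [IsStrictOrderedRing R] in
/-- Splitting the normaliser at the hub. -/
lemma Z_eq_hub_add (t₀ t : α) :
    Z D W t = cw D W t₀ t + ∑ s ∈ Finset.univ.erase t₀, cw D W s t := by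
  unfold Z
  exact (Finset.add_sum_erase _ _ (Finset.mem_univ t₀)).symm

/-- **Doeblin upper bound**: `K u t ≤ hi u − ε (hi u − u t₀)`. -/
lemma K_le_hi_sub (hW : ∀ s, 0 ≤ W s) {t₀ : α} (hD0 : ∀ t, D t₀ t) (h0 : 0 < W t₀)
    (u : α → R) (t : α) : K D W u t ≤ hi t₀ u - eps W t₀ * (hi t₀ u - u t₀) := by
  have hZ : 0 < Z D W t := Z_pos hW (hD0 t) h0
  have hsum : ∑ s, cw D W s t * u s ≤ Z D W t * hi t₀ u - W t₀ * (hi t₀ u - u t₀) := by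
    rw [sum_cw_mul_eq_hub_add u t₀ t, Z_eq_hub_add t₀ t, cw_of_D (hD0 t)]
    have h1 : ∑ s ∈ Finset.univ.erase t₀, cw D W s t * u s ≤
        ∑ s ∈ Finset.univ.erase t₀, cw D W s t * hi t₀ u :=
      Finset.sum_le_sum fun s _ => mul_le_mul_of_nonneg_left (le_hi t₀ u s) (cw_nonneg (D := D) hW s t)
    rw [← Finset.sum_mul] at h1
    nlinarith [h1]
  have hε : eps W t₀ * (hi t₀ u - u t₀) ≤ (W t₀ / Z D W t) * (hi t₀ u - u t₀) :=
    mul_le_mul_of_nonneg_right (eps_le_div_Z hW (hD0 t) h0) (sub_nonneg.mpr (le_hi t₀ u t₀))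
  unfold K
  rw [div_le_iff₀ hZ]
  calc ∑ s, cw D W s t * u s ≤ Z D W t * hi t₀ u - W t₀ * (hi t₀ u - u t₀) := hsum
    _ = (hi t₀ u - (W t₀ / Z D W t) * (hi t₀ u - u t₀)) * Z D W t := by
        field_simp
    _ ≤ (hi t₀ u - eps W t₀ * (hi t₀ u - u t₀)) * Z D W t :=
        mul_le_mul_of_nonneg_right (by linarith) hZ.le

/-- **Doeblin lower bound**: `lo u + ε (u t₀ − lo u) ≤ K u t`. -/
lemma lo_add_le_K (hW : ∀ s, 0 ≤ W s) {t₀ : α} (hD0 : ∀ t, D t₀ t) (h0 : 0 < W t₀)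
    (u : α → R) (t : α) : lo t₀ u + eps W t₀ * (u t₀ - lo t₀ u) ≤ K D W u t := by
  have hZ : 0 < Z D W t := Z_pos hW (hD0 t) h0
  have hsum : Z D W t * lo t₀ u + W t₀ * (u t₀ - lo t₀ u) ≤ ∑ s, cw D W s t * u s := by
    rw [sum_cw_mul_eq_hub_add u t₀ t, Z_eq_hub_add t₀ t, cw_of_D (hD0 t)]
    have h1 : ∑ s ∈ Finset.univ.erase t₀, cw D W s t * lo t₀ u ≤
        ∑ s ∈ Finset.univ.erase t₀, cw D W s t * u s :=
      Finset.sum_le_sum fun s _ => mul_le_mul_of_nonneg_left (lo_le t₀ u s) (cw_nonneg (D := D) hW s t)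
    rw [← Finset.sum_mul] at h1
    nlinarith [h1]
  have hε : eps W t₀ * (u t₀ - lo t₀ u) ≤ (W t₀ / Z D W t) * (u t₀ - lo t₀ u) :=
    mul_le_mul_of_nonneg_right (eps_le_div_Z hW (hD0 t) h0) (sub_nonneg.mpr (lo_le t₀ u t₀))
  unfold K
  rw [le_div_iff₀ hZ]
  calc (lo t₀ u + eps W t₀ * (u t₀ - lo t₀ u)) * Z D W t
      ≤ (lo t₀ u + (W t₀ / Z D W t) * (u t₀ - lo t₀ u)) * Z D W t :=
        mul_le_mul_of_nonneg_right (by linarith) hZ.le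
    _ = Z D W t * lo t₀ u + W t₀ * (u t₀ - lo t₀ u) := by field_simp
    _ ≤ ∑ s, cw D W s t * u s := hsum

end AltNonneg

section AltCondPA

variable {R : Type*} [Field R] [LinearOrder R]
variable {α : Type*} [Fintype α] [Preorder α]

/-- The positive-association hypothesis (H1) on every conditional weight `cw (·, t)`. -/
def CondPA (D : α → α → Prop) [DecidableRel D] (W : α → R) : Prop :=
  ∀ t (g h : α → R), Monotone g → Monotone h →
    (∑ s, cw D W s t * g s) * (∑ s, cw D W s t * h s) ≤
      (∑ s, cw D W s t * (g s * h s)) * Z D W t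

end AltCondPA

end Summit.Ventures.PercRepro2.WForm
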